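import Summits.BirchSwinnertonDyer.BirchSwinnertonDyer.Theorems.QuadraticBranchSignedControlPlusEtaNonsurjGoodFrobenius
import HarnessLib

/-!
# Route `QuadraticBranchSignedControl` (rung K8, cell `bsd-potss`): crux stmt-BirchSwinnertonDyer-19606
# `PlusEtaMainConjectureNonsurj` — THE FIXED-VECTOR DICHOTOMY AT A GOOD PRIME OF A ROW:
# `Ẽ(𝔽_ℓ)[p] ≠ 0 ⟹ (Frob_ℓ = 1 on V[p] ∧ ℓ ≡ 1)  ∨  (Frob_ℓ ∉ H_V, Frob_ℓ² = 1 ∧ ℓ ≡ −1 (mod p))`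

WHAT. Continuation of `…PlusEtaNonsurjGoodFrobenius` (k8eta-c2 g13: discriminant law, Frobenius square, anomalous primes `≡ ±1`).
On a curve with `Im ρ̄_{V,p} = C_ns⁺(p)` (every row of crux 19606) let `σ` be an arithmetic Frobenius at a good prime `ℓ ≠ p` that
FIXES a non-zero point of `V[p]` — equivalently `p ∣ #Ẽ(𝔽_ℓ)`, `ℓ` an ANOMALOUS prime, the primes at which the local terms of the
Hatley–Lei / Corpuz–Lei `λ`-transfer formula can be non-zero. Then (`frob_fixed_dichotomy`): EITHER `ρ̄(σ) ∈ C_ns` and then `ρ̄(σ) = 1`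
(a Cartan element with a rational fixed vector is the identity, `eq_one_of_mem_nonsplitCartan_of_mulVec_eq_self`) and `ℓ = det ρ̄(σ) ≡ 1`
— `ℓ` splits completely in `ℚ(V[p])`, BOTH roots of `1 − a_ℓX + ℓX²` are `ℓ⁻¹ ≡ 1` (the DOUBLE-root case of the multiplicity rule);
OR `ρ̄(σ)` is off the Cartan (`ℓ` inert in the Cartan field `K_V`), `ρ̄(σ)² = −ℓ` (trace `0`, Cayley–Hamilton) fixes the point, so
`ℓ ≡ −1` and `σ² = 1` on `V[p]` (simple root). Row-level wrappers `…_of_row`, `frob_trivial_of_centralizes_sq_of_fixed_of_row`.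

HONEST FRAMING (cell `bsd-potss`, run/shared/lean/pub/bsd-potss/; FULL-BSD rank ≤ 1 programme): TOOL THEOREMS ONLY (no definition,
no named fact, no `sorry`, axioms standard). Nothing is booked; crux 19606 stays OPEN; `BSD(W, p)` is claimed for no pair. Seat
`bsd-potss-k8eta-c2` g13 (prover), `--supports stmt-BirchSwinnertonDyer-19606`.

References: [Serre1972] §2.2; [Serre1981] §8.1 (238); [DarmonDiamondTaylor1995] Prop. 2.8 (a); [Zywina2015] Thm. 1.4;
J. Hatley, A. Lei, «Comparing anticyclotomic Selmer groups…» / arithmetic of the `λ`-invariant local terms (Prop. 5.1: multiplicity of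
`ℓ⁻¹` as a root of the Euler factor mod `p`).
-/

set_option autoImplicit false
set_option linter.dupNamespace false

noncomputable section

open scoped Classical NumberField

open Matrix Field IsDedekindDomain NumberField WeierstrassCurve Literature.NumberTheory.EllipticCurves
  Literature.NumberTheory.GaloisRepresentations Literature.NumberTheory.SerreUniformity
  Literature.NumberTheory.EllipticCurves.Rank1Residual Rat.HeightOneSpectrum

namespace Summit.BirchSwinnertonDyer.BirchSwinnertonDyer.Theorems.EtaCartanField

variable {p : ℕ} [hp : Fact p.Prime]

/-! ## §1 A Cartan element with a fixed vector is trivial; §2 the dichotomy on a row -/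

section FixedVector

omit hp in
/-- **A Cartan element with a non-zero FIXED vector is the identity**: `M = (a, εb; b, a)`, `ε` non-square, `Mx = x`, `x ≠ 0`
`⟹ M = 1`. [cite: Serre1972, §2.2] -/
theorem eq_one_of_mem_nonsplitCartan_of_mulVec_eq_self [Fact p.Prime] {ε : ZMod p} (hε : ¬ IsSquare ε)
    {M : Matrix (Fin 2) (Fin 2) (ZMod p)} (hM : M ∈ nonsplitCartan ε) {x : Fin 2 → ZMod p} (hx : x ≠ 0)
    (hMx : M *ᵥ x = x) : M = 1 := by
  obtain ⟨a, b, -, rfl⟩ := hM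
  have h1 : a * x 0 + ε * b * x 1 = x 0 := by
    have := congrFun hMx 0
    simpa [Matrix.mulVec, dotProduct, Fin.sum_univ_two, mul_assoc] using this
  have h2 : b * x 0 + a * x 1 = x 1 := by
    have := congrFun hMx 1
    simpa [Matrix.mulVec, dotProduct, Fin.sum_univ_two] using this
  have hb : b = 0 := by
    by_contra hb
    apply hε
    have hx1 : x 1 ≠ 0 := by
      intro hx1
      simp only [hx1, mul_zero, add_zero] at h2
      have hx0 : x 0 = 0 := by
        rcases mul_eq_zero.mp h2 with h | h
        · exact absurd h hb
        · exact h
      exact hx (funext fun i => by fin_cases i <;> assumption)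
    refine ⟨(1 - a) / b, ?_⟩
    have e0 : b * x 0 = (1 - a) * x 1 := by linear_combination h2
    have e1 : ε * b * x 1 = (1 - a) * x 0 := by linear_combination h1
    have key : ε * b * b * x 1 = (1 - a) * (1 - a) * x 1 := by
      calc ε * b * b * x 1 = (ε * b * x 1) * b := by ring
        _ = ((1 - a) * x 0) * b := by rw [e1]
        _ = (1 - a) * (b * x 0) := by ring
        _ = (1 - a) * ((1 - a) * x 1) := by rw [e0]
        _ = (1 - a) * (1 - a) * x 1 := by ring
    have := mul_right_cancel₀ hx1 key
    field_simp
    linear_combination this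
  subst hb
  have ha : a = 1 := by
    by_cases hx0 : x 0 = 0
    · have hx1 : x 1 ≠ 0 := fun hx1 => hx (funext fun i => by fin_cases i <;> assumption)
      rw [zero_mul, zero_add] at h2
      exact mul_right_cancel₀ hx1 (by rw [h2, one_mul])
    · rw [mul_zero, zero_mul, add_zero] at h1
      exact mul_right_cancel₀ hx0 (by rw [h1, one_mul])
  subst ha
  ext i j
  fin_cases i <;> fin_cases j <;> simp

variable (V : WeierstrassCurve ℚ) [V.IsElliptic] [V.IsGloballyMinimal]

omit [V.IsGloballyMinimal] in
/-- **The fixed-vector dichotomy.** Let `Im ρ̄_{V,p} = C_ns⁺(p)` (`p ≠ 2`), `ℓ ≠ p` a good prime, `σ` an arithmetic Frobenius at a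
prime `𝔓 ∣ ℓ`, and suppose `σ` FIXES a non-zero `P ∈ V[p]` (equivalently `Ẽ(𝔽_ℓ)[p] ≠ 0`, i.e. `p ∣ #Ẽ(𝔽_ℓ)`: `ℓ` anomalous). Then
EITHER `σ` acts trivially on `V[p]` and `ℓ ≡ 1 (mod p)` (`ρ̄(σ) ∈ C_ns` with a rational fixed vector is `1`; `det = ℓ`) — `ℓ` splits
completely in `ℚ(V[p])`, `Ẽ(𝔽_ℓ)[p] = V[p]` — OR `σ ∉ H_V` (`ℓ` inert in the Cartan field), `σ² = 1` on `V[p]` and `ℓ ≡ −1 (mod p)`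
(`ρ̄(σ)² = −det = −ℓ` must fix `P`). This is the kernel form of the multiplicity rule of the `λ`-transfer's local term at a good
anomalous prime: a DOUBLE root `ℓ⁻¹` of `1 − a_ℓX + ℓX²` mod `p` exactly when `ℓ ≡ 1 (mod p)`. [cite: Serre1972, §2.2]
[cite: Serre1981, §8.1 (238)] [cite: DarmonDiamondTaylor1995, Prop. 2.8 (a)] -/
theorem frob_fixed_dichotomy (hp2 : p ≠ 2) (h : HasModPImageEqNonsplitCartanNormalizer V p) (ℓ : ℕ) [Fact ℓ.Prime]
    (hℓp : ℓ ≠ p) (hgood : V.HasGoodReductionAtPrime ℓ) {v : HeightOneSpectrum (𝓞 ℚ)} (hv : (primesEquiv v : ℕ) = ℓ)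
    {𝔓 : Ideal (absIntegers (𝓞 ℚ) ℚ)} (h𝔓 : 𝔓 ∈ v.primesAbove) {σ : absoluteGaloisGroup ℚ} (hσ : IsArithFrobAt (𝓞 ℚ) σ 𝔓)
    {P : V.geomTorsion p} (hP : P ≠ 0) (hfix : σ • P = P) :
    ((∀ Q : V.geomTorsion p, σ • Q = Q) ∧ (ℓ : ZMod p) = 1) ∨
      ((¬ ∀ (τ : absoluteGaloisGroup ℚ) (Q : V.geomTorsion p), σ • ((τ * τ) • Q) = (τ * τ) • (σ • Q)) ∧
        (∀ Q : V.geomTorsion p, σ • (σ • Q) = Q) ∧ (ℓ : ZMod p) = -1) := by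
  letI : Module (ZMod p) (V.geomTorsion p) := AddSubgroup.torsionBy.zmodModule
  obtain ⟨e, ε, hε, himg, hsurj⟩ := h
  obtain ⟨M, hM, hσM⟩ := himg σ
  have hx : e P ≠ 0 := fun h0 => hP (e.injective (by rw [h0, map_zero]))
  have hMx : M *ᵥ e P = e P := by rw [← hσM, hfix]
  have hdet : M.det = (ℓ : ZMod p) := by
    rw [← det_eq_matrix_det e hσM, V.det_galoisRepTorsion_frobenius_eq p hℓp hgood hv h𝔓 hσ]
  by_cases hMC : M ∈ nonsplitCartan ε
  · left
    have hM1 : M = 1 := eq_one_of_mem_nonsplitCartan_of_mulVec_eq_self hε hMC hx hMx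
    refine ⟨fun Q => e.injective (by rw [hσM, hM1, Matrix.one_mulVec]), ?_⟩
    rw [← hdet, hM1, Matrix.det_one]
  · right
    have htr : M.trace = 0 := trace_eq_zero_of_not_mem_nonsplitCartan hM hMC
    have hsq : ∀ x : Fin 2 → ZMod p, M *ᵥ (M *ᵥ x) = -((ℓ : ZMod p) • x) := fun x => by
      rw [mulVec_mulVec_eq_neg_det_smul_of_trace_eq_zero htr, hdet]
    -- `P = σ²P = −ℓ P` forces `ℓ = −1`
    have hℓ : (ℓ : ZMod p) = -1 := by
      have h1 := hsq (e P)
      rw [hMx, hMx] at h1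
      -- `e P = -(ℓ • e P)`, so `(ℓ + 1) • e P = 0` with `e P ≠ 0`
      have h2 : ((ℓ : ZMod p) + 1) • e P = 0 := by
        rw [add_smul, one_smul]
        have : (ℓ : ZMod p) • e P = -e P := by
          have := congrArg Neg.neg h1
          rw [neg_neg] at this
          exact this.symm
        rw [this, neg_add_cancel]
      rcases smul_eq_zero.mp h2 with h3 | h3
      · linear_combination h3
      · exact absurd h3 hx
    refine ⟨fun hcen => hMC ((matrix_mem_nonsplitCartan_iff_centralizes_sq hp2 e hε himg hsurj hM hσM).mpr hcen),
      fun Q => e.injective ?_, hℓ⟩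
    rw [hσM, hσM, hsq, hℓ, neg_smul, one_smul, neg_neg]

/-- **Row form of the fixed-vector dichotomy** (hypotheses of crux 19606: `V/ℚ` globally minimal, `p ≥ 5` good, `a_p = 0`, tower not
onto): an arithmetic Frobenius at a good `ℓ ≠ p` fixing a non-zero point of `V[p]` is trivial on `V[p]` with `ℓ ≡ 1 (mod p)`, or lies
outside the Cartan subgroup, squares to `1` on `V[p]`, with `ℓ ≡ −1 (mod p)`. [cite: Serre1972, §2.2] [cite: Zywina2015, Thm. 1.4] -/
theorem frob_fixed_dichotomy_of_row (p : ℕ) [Fact p.Prime] (hp5 : 5 ≤ p) (hgood : V.HasGoodReductionAtPrime p)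
    (hap : V.frobeniusTrace p = 0) (hns : ¬ ∀ m : ℕ, V.HasSurjectiveModNGaloisRep (p ^ m : ℕ)) (ℓ : ℕ) [Fact ℓ.Prime]
    (hℓp : ℓ ≠ p) (hgoodℓ : V.HasGoodReductionAtPrime ℓ) {v : HeightOneSpectrum (𝓞 ℚ)} (hv : (primesEquiv v : ℕ) = ℓ)
    {𝔓 : Ideal (absIntegers (𝓞 ℚ) ℚ)} (h𝔓 : 𝔓 ∈ v.primesAbove) {σ : absoluteGaloisGroup ℚ} (hσ : IsArithFrobAt (𝓞 ℚ) σ 𝔓)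
    {P : V.geomTorsion p} (hP : P ≠ 0) (hfix : σ • P = P) :
    ((∀ Q : V.geomTorsion p, σ • Q = Q) ∧ (ℓ : ZMod p) = 1) ∨
      ((¬ ∀ (τ : absoluteGaloisGroup ℚ) (Q : V.geomTorsion p), σ • ((τ * τ) • Q) = (τ * τ) • (σ • Q)) ∧
        (∀ Q : V.geomTorsion p, σ • (σ • Q) = Q) ∧ (ℓ : ZMod p) = -1) :=
  frob_fixed_dichotomy V (by omega) (hasModPImageEqNonsplitCartanNormalizer_of_row V p hp5 hgood hap hns) ℓ hℓp hgoodℓ hv h𝔓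
    hσ hP hfix

/-- **Corollary: a Frobenius in the Cartan subgroup with a non-zero fixed vector on `V[p]` is trivial on `V[p]`** (split anomalous
primes of a row split completely in `ℚ(V[p])`). [cite: Serre1972, §2.2] -/
theorem frob_trivial_of_centralizes_sq_of_fixed_of_row (p : ℕ) [Fact p.Prime] (hp5 : 5 ≤ p)
    (hgood : V.HasGoodReductionAtPrime p) (hap : V.frobeniusTrace p = 0)
    (hns : ¬ ∀ m : ℕ, V.HasSurjectiveModNGaloisRep (p ^ m : ℕ)) (ℓ : ℕ) [Fact ℓ.Prime] (hℓp : ℓ ≠ p)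
    (hgoodℓ : V.HasGoodReductionAtPrime ℓ) {v : HeightOneSpectrum (𝓞 ℚ)} (hv : (primesEquiv v : ℕ) = ℓ)
    {𝔓 : Ideal (absIntegers (𝓞 ℚ) ℚ)} (h𝔓 : 𝔓 ∈ v.primesAbove) {σ : absoluteGaloisGroup ℚ} (hσ : IsArithFrobAt (𝓞 ℚ) σ 𝔓)
    (hcen : ∀ (τ : absoluteGaloisGroup ℚ) (Q : V.geomTorsion p), σ • ((τ * τ) • Q) = (τ * τ) • (σ • Q))
    {P : V.geomTorsion p} (hP : P ≠ 0) (hfix : σ • P = P) :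
    (∀ Q : V.geomTorsion p, σ • Q = Q) ∧ (ℓ : ZMod p) = 1 := by
  rcases frob_fixed_dichotomy_of_row V p hp5 hgood hap hns ℓ hℓp hgoodℓ hv h𝔓 hσ hP hfix with h | h
  · exact h
  · exact absurd hcen h.1

end FixedVector

end Summit.BirchSwinnertonDyer.BirchSwinnertonDyer.Theorems.EtaCartanField

end
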